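import Summits.ABC.IUTFork.Conditional.WRowBrobergMixedSeven
import Summits.ABC.IUTFork.Conditional.WRowBrobergTypes
import Summits.ABC.IUTFork.Conditional.WRowBrobergUniformCells
import HarnessLib

/-!
# R-W WINDOW-TABLE, Broberg `ℚ(√7)` point — the hull licence S_H INHABITED at EVERY genuine Θ-volume datum at EVERY level `l`
# (uniform in `l`; no local-type, conjugacy, fibre-shape, number-level or level hypothesis)

PROOF-ONLY file (D-0012; 0 definitions, 0 `Prop` facts) of the abc-iut cell (seat abc-iut-w6-d055, gen 10). Rows 9/10 of
HOME/plan/rescue/R-W/OPEN-10.md (`pilotDataOfK:broberg-Q7:7 / :11`, N. Broberg's `abc`-example over `ℚ(√7)`,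
`λ = (8−3√7)²(5−2√7)/(4−3√7)⁴`, poles of `j(λ)` at `𝔭₃ = (2+√7)` (`h = 2`), `𝔭₃' = (√7−2)` (`h = 24`), `𝔭₄₇ = (3√7−4)` (`h = 8`)) were
decided INHABITED UNCONDITIONALLY at `l = 7` and `l = 11` by abc-iut-W-row-2 (gens 2/3: `WRowBrobergMixedSeven` / `…Eleven`,
`WRowBrobergUnconditionalSeven` / `…Eleven`, p486684 / p496949 / p497044) with `l`-SPECIFIC cells. This file proves the same at a
SYMBOLIC level: gen 2's mixed-fibre composition over abc-iut-w5-d180's socket `Thm311.Real.licence_settingPrVolSharp_of_mixedOrders_of_realises`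
(`Cor312LicenceWildInhabitedMixed`, p476904) with the SAME local packages (`D = e − 1`; `ρin = e/2` over `3`, `1` over `47`;
`ρout = min(3⁴ − 4e, 3⁵ − 5e)` / `min(3⁵ − 5e, 3⁶ − 6e)` / `min(47 − e, 47² − 2e)`; auxiliary prime `5 ∣ e` off the cyclotomic indices), the
three cell families discharged for EVERY `l ≥ 5`, every label `j ≤ (l−1)/2` and every admissible index by `WRowBrobergUniformCells`
(all-A: exponent 5 for `l ≥ 17`, exponent 4 for `l ≤ 16`; all-C: exponent 1; B-present: `j²/l < 2(j+1)`), and the level-free fibre shape of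
gen 3's `WRow.exists_brobergTypes` (`WRowBrobergTypes`, p496514: `e ∈ 10lℕ / 30lℕ / 15lℕ`, `P_q = 12e/l · e/l · 4e/l`). TAKES NO SIDE on
[IUTchIII] Cor. 3.12 (S. Mochizuki, *Inter-universal Teichmüller theory III*, Cor. 3.12 p. 173–174; Step (xi-f) p. 184) or on any author;
«inhabited as typed» ≠ «asserted in print».

WHAT IS PROVED (namespace `Summit.ABC.IUTFork.Conditional`):
* `WRow.licence_of_brobergTypes_all` — gen 2's `WRow.licence_of_brobergTypes_seven` with `l⋆ = 3` replaced by ANY `l ≥ 5` with `X.l = l`;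
* **`WRow.licence_broberg_all`** — for EVERY level `l`, EVERY genuine Θ-volume datum `T : Cor22.ThetaVolumeDatumAt Broberg.point l` and
  EVERY pair of Θ- and q-ideles REALISING the pilot divisors of `X := pilotDataOfK T.D T.K`: abc-iut-c312-1's `Thm311ToCor312.Licence` HOLDS
  at abc-iut-c312-7's `settingPrVolSharp X …` — hypotheses = the datum and the realising identities ONLY (the datum carries `l` prime `≥ 5`);
* **`WRow.exists_qPinned_and_hull_broberg_all`** — branch C's per-datum antecedent «∃ ρ qK, QPinned ∧ PilotKummerCompatHull» there, any columns.
READING (neutral): the S_H object of the window certificates' binder `hSHwBad` / `hSHw` (p453137 / p450130) is INHABITED at EVERY genuine datum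
over Broberg's point at EVERY level (`L₀ = 5`; rows 9/10 = the instances `l = 7, 11`) — a §S-class «DECIDED-AT-EVERY-l» theorem, NOT a table row.
HONEST SCOPE: OUR sharp genuine `K`-containers and Dupuy–Hilado's typed (Ind1)/(Ind2); STRONGER-THAN-PRINT hull reading of Step (xi-f);
NON-EMPTINESS of the datum type, admissibility / (P6), Szpiro-badness NOT claimed; nothing about the printed GLOBAL inequality; no abc claim.
[cite: Mochizuki2012, IUTchI Def. 3.1 (b),(c) pp. 61–62, Rmk. 3.1.5 p. 65, Ex. 3.2 (iv) p. 71; IUTchIII Cor. 3.12 Step (xi-d) p. 183, (xi-f) p. 184, Thm. 3.11 (i) (Ind1)(Ind2) p. 154; IUTchIV Prop. 1.1 p. 9, Prop. 1.2 (i)(ii) p. 10, Prop. 1.4 (i)(ii) p. 13, Cor. 2.2 (ii) proof (P5),(P7) p. 46]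
[cite: DupuyHilado2025, §3.3, §3.4, §3.9, §4.9, §4.12] [cite: NeukirchANT1999, Ch. II (5.5)–(5.7)] [claim: Mochizuki2012, status: disputed] for every IUT sentence.
-/

noncomputable section

open Set Function Metric NumberField IsDedekindDomain

namespace Summit.ABC.IUTFork.Conditional

open Thm311 Thm311.Real Cor312 Cor312.Setting Cor312Vol Cor312Prov Literature.IUT.LogThetaLattice Literature.IUT.LogVolume
  Literature.IUT.HodgeTheaters
open Literature.NumberTheory.NumberFields Literature.NumberTheory.GaloisRepresentations.Ultrametric
open Literature.IUT.LogVolume.Cor22 Literature.NumberTheory.DiophantineGeometry Literature.NumberTheory.DiophantineGeometry.GenEll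
  Summit.ABC.IUTFork.Broberg

/-! ## The composition at a symbolic level `l ≥ 5` -/

variable {F : Type} [Field F] [NumberField F] (X : PilotData F) {logv : PadicLogs F} (hlog : LogvAnalytic logv)
  (M : Type) [Field M] [NumberField M]
  (archPk : ∀ (j : (thetaIndex X).Label) (vQ : (thetaIndex X).VQ), Set ((logShellsDH X logv).Packet j vQ))
  (archSub : ∀ (j : (thetaIndex X).Label) (v : (thetaIndex X).V),
    Set ((logShellsDH X logv).Packet j ((thetaIndex X).over v)))
  (Ψ : ℤ → ∀ v : (thetaIndex X).V, v ∈ (thetaIndex X).Vbad → Set ((logShellsDH X logv).StarPacket v))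
  (act : ℤ → ∀ v : (thetaIndex X).V, v ∈ (thetaIndex X).Vbad →
    (logShellsDH X logv).StarPacket v → Module.End ℚ ((logShellsDH X logv).StarPacket v))
  (Mmod : ℤ → ∀ j : (thetaIndex X).LabelStar, Set ((logShellsDH X logv).GlobalPacket j.1))
  (region : ℤ → ∀ j : (thetaIndex X).LabelStar, FinDivisor M → ∀ vQ : (thetaIndex X).VQ,
    Set ((logShellsDH X logv).Packet j.1 vQ))
  (n : ℤ) {HT : Type} {LogLink : HT → HT → Type} {IsFull : ∀ {s t : HT}, LogLink s t → Prop}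
  (lat : LGPGaussianLogThetaLattice LogLink IsFull)
  {Frd : Type} {IsoF : Frd → Frd → Type} {Ob : Frd → Type} {realify : Frd → Frd} {Strip : Type}
  {IsoS : Strip → Strip → Type} {Mv : ∀ v : (thetaIndex X).V, v ∈ (thetaIndex X).Vbad → Type}
  [∀ v h, Monoid (Mv v h)]
  (sig : GlobalLGPFrobenioidSignature (thetaIndex X).lstar (thetaIndex X).V (· ∈ (thetaIndex X).Vbad)
    Frd IsoF Ob realify Strip IsoS Mv)
  (split : SplittingMonoids Mv) {ObΔ : Type} {N : ∀ v : (thetaIndex X).V, v ∈ (thetaIndex X).Vbad → Type}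
  [∀ v h, Monoid (N v h)] (qData : QPilotData ObΔ N)
  (tq : ∀ (pp : Nat.Primes) (x : (thetaIndex X).Fibre (.inr pp)), haveI : Fact (pp : ℕ).Prime := ⟨pp.2⟩; kOf X pp.1 x)
  (t : ∀ (pp : Nat.Primes) (_ : Fin X.lstar) (x : (thetaIndex X).Fibre (.inr pp)),
    haveI : Fact (pp : ℕ).Prime := ⟨pp.2⟩; kOf X pp.1 x)
  (htq0 : ∀ pp x, tq pp x ≠ 0)
  (htq1 : ∀ (pp : Nat.Primes) (x : (thetaIndex X).Fibre (.inr pp)),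
    haveI : Fact (pp : ℕ).Prime := ⟨pp.2⟩; placeOf X pp.1 x ∉ X.S → ‖tq pp x‖ = 1)
  (col : ℤ → Column (logShellsDH X logv))
  (ht0 : ∀ pp i x, t pp i x ≠ 0)
  (ht : ∀ (pp : Nat.Primes) (i : Fin X.lstar) (x : (thetaIndex X).Fibre (.inr pp)),
    haveI : Fact (pp : ℕ).Prime := ⟨pp.2⟩
    Real.log ‖t pp i x‖ = -(X.thetaPilot i (placeOf X pp.1 x)) * logNorm F (placeOf X pp.1 x) /
      localDegree F (placeOf X pp.1 x))
  (htq : ∀ (pp : Nat.Primes) (x : (thetaIndex X).Fibre (.inr pp)),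
    haveI : Fact (pp : ℕ).Prime := ⟨pp.2⟩
    Real.log ‖tq pp x‖ = -(X.qPilot (placeOf X pp.1 x)) * logNorm F (placeOf X pp.1 x) /
      localDegree F (placeOf X pp.1 x))

include ht0 ht htq in
/-- **Broberg-shaped data at a SYMBOLIC level `l ≥ 5`, INHABITED SIDE, over the MIXED-FIBRE socket — modulo the local types BY NAME.**
For ANY pilot data `X` over any number field with `X.l = l ≥ 5`, any analytic `p`-adic logarithms, any pair of Θ- and q-ideles REALISING the
pilot divisors, and a type map `c` on the fibres: IF the bad places of `X` lie over `3` and `47` only (`hbad`), those over `3` fall into two types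
— type A (`c x = 0`): `e(K_x/ℚ_3) = eA` and `P_q(x) = 12·eA/l` (the `h = 24` place), type B (`c x = 1`): `e(K_x/ℚ_3) = eB`, `P_q(x) = eB/l`
(the `h = 2` place) — and those over `47` form one type (`c x = 0`, `e = eC`, `P_q(x) = 4·eC/l`, `h = 8`), with `10l ∣ eA`, `30l ∣ eB`,
`15l ∣ eC` and bad completions of the SAME type `ℚ_p`-isomorphic (`hiso`), THEN abc-iut-c312-1's `Thm311ToCor312.Licence` HOLDS at
abc-iut-c312-7's `settingPrVolSharp X …`. Discharged inside (no hypothesis), exactly as in gen 2's `WRow.licence_of_brobergTypes_seven`: the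
differents `D = e − 1`, the inner radii `ρin = e/2` over `3` (`WRow.inner_witness_slot`) and `1` over `47`, the outer radii
`ρout = min(3⁴ − 4eA, 3⁵ − 5eA)`, `min(3⁵ − 5eB, 3⁶ − 6eB)`, `min(47 − eC, 47² − 2eC)` (`WRow.outer_member_min`; the auxiliary prime `5 ∣ e` puts `e`
off the cyclotomic indices `p^c(p−1)` for `p = 3, 47`), and the socket's TYPE-PROFILE cells at every label `j ≤ (l−1)/2` and every profile: with a
slot of the SHALLOW type B present, `s :=` that slot (Θ-side `≤ j²/l < 2(j+1) ≤` q-side, `WRow.broberg_cellB_side`); all-A / all-C profiles by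
`WRow.broberg_cellA_num` / `WRow.broberg_cellC_num` at `e = 10l·k`, `15l·k`, every `k ≥ 1`. [cite: Mochizuki2012, IUTchI Def. 3.1 (b),(c) pp. 61–62; IUTchIII Cor. 3.12 Step (xi-d) p. 183, (xi-f) p. 184, Thm. 3.11 (i) (Ind1)(Ind2) p. 154; IUTchIV Prop. 1.1 p. 9, Prop. 1.2 (i)(ii) p. 10, Prop. 1.4 (i)(ii) p. 13, Cor. 2.2 (ii) proof (P5) p. 46]
[cite: DupuyHilado2025, §3.3, §3.4, §3.9, §4.9, §4.12] [claim: Mochizuki2012, status: disputed] -/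
theorem WRow.licence_of_brobergTypes_all {l : ℕ} (hXl : X.l = l) (hl5 : 5 ≤ l)
    (c : ∀ pp : Nat.Primes, (thetaIndex X).Fibre (.inr pp) → Fin 2) (eA eB eC : ℕ)
    (hdA : 10 * l ∣ eA) (hdB : 30 * l ∣ eB) (hdC : 15 * l ∣ eC)
    (hbad : ∀ (pp : Nat.Primes) (x : (thetaIndex X).Fibre (.inr pp)), haveI : Fact (pp : ℕ).Prime := ⟨pp.2⟩
      placeOf X pp.1 x ∈ X.S → (pp : ℕ) = 3 ∨ (pp : ℕ) = 47)
    (h3 : ∀ (pp : Nat.Primes) (x : (thetaIndex X).Fibre (.inr pp)), haveI : Fact (pp : ℕ).Prime := ⟨pp.2⟩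
      (pp : ℕ) = 3 → placeOf X pp.1 x ∈ X.S →
        (c pp x = 0 → absRamificationIdx (pp : ℕ) (kOf X pp.1 x) = eA ∧ X.qPilot (placeOf X pp.1 x) = ((12 * eA / l : ℕ) : ℝ)) ∧
        (c pp x = 1 → absRamificationIdx (pp : ℕ) (kOf X pp.1 x) = eB ∧ X.qPilot (placeOf X pp.1 x) = ((eB / l : ℕ) : ℝ)))
    (h47 : ∀ (pp : Nat.Primes) (x : (thetaIndex X).Fibre (.inr pp)), haveI : Fact (pp : ℕ).Prime := ⟨pp.2⟩
      (pp : ℕ) = 47 → placeOf X pp.1 x ∈ X.S →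
        c pp x = 0 ∧ absRamificationIdx (pp : ℕ) (kOf X pp.1 x) = eC ∧ X.qPilot (placeOf X pp.1 x) = ((4 * eC / l : ℕ) : ℝ))
    (hiso : ∀ (pp : Nat.Primes) (x y : (thetaIndex X).Fibre (.inr pp)),
      haveI : Fact (pp : ℕ).Prime := ⟨pp.2⟩
      placeOf X pp.1 x ∈ X.S → placeOf X pp.1 y ∈ X.S → c pp x = c pp y → Nonempty (kOf X pp.1 x ≃ₐ[ℚ_[pp]] kOf X pp.1 y)) :
    Thm311ToCor312.Licence (settingPrVolSharp X hlog M archPk archSub Ψ act Mmod region n lat sig split qData tq t htq0 htq1) := by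
  classical
  -- the per-type data fed to the socket
  let eT : Nat.Primes → Fin 2 → ℕ := fun pp u => if (pp : ℕ) = 3 then (if u = 0 then eA else eB) else eC
  let DT : Nat.Primes → Fin 2 → ℕ := fun pp u => eT pp u - 1
  let PT : Nat.Primes → Fin 2 → ℕ := fun pp u => if (pp : ℕ) = 3 then (if u = 0 then 12 * eA / l else eB / l) else 4 * eC / l
  let rinT : Nat.Primes → Fin 2 → ℤ := fun pp u => if (pp : ℕ) = 3 then ((eT pp u / 2 : ℕ) : ℤ) else 1
  let routT : Nat.Primes → Fin 2 → ℤ := fun pp u =>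
    if (pp : ℕ) = 3 then (if u = 0 then min ((3 : ℤ) ^ 4 - 4 * (eA : ℤ)) ((3 : ℤ) ^ 5 - 5 * (eA : ℤ))
      else min ((3 : ℤ) ^ 5 - 5 * (eB : ℤ)) ((3 : ℤ) ^ 6 - 6 * (eB : ℤ)))
    else min ((47 : ℤ) ^ 1 - 1 * (eC : ℤ)) ((47 : ℤ) ^ 2 - 2 * (eC : ℤ))
  have h01 : ∀ u : Fin 2, u = 0 ∨ u = 1 := by decide
  refine licence_settingPrVolSharp_of_mixedOrders_of_realises X hlog M archPk archSub Ψ act Mmod region n lat sig split qData tq t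
    htq0 htq1 ht0 ht htq (fun _ => 2) c eT DT PT rinT routT (fun pp x hx => ?_) hiso (fun pp i f hocc => ?_)
  · -- the local packages at a bad place
    haveI : Fact (pp : ℕ).Prime := ⟨pp.2⟩
    rcases hbad pp x hx with hp | hp
    · -- over `3`: type A (`u = 0`) or type B (`u = 1`)
      have hne5 : ∀ {e : ℕ}, 5 ∣ e → ∀ k : ℕ, (e : ℤ) ≠ (((pp : ℕ) : ℕ) : ℤ) ^ k * ((((pp : ℕ) : ℕ) : ℤ) - 1) := fun h5 =>
        WRow.natCast_ne_pow_mul_sub_one Nat.prime_five pp.2 (by rw [hp]; norm_num) (by rw [hp]; norm_num) h5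
      rcases h01 (c pp x) with hu | hu
      · obtain ⟨hE, hP⟩ := (h3 pp x hp hx).1 hu
        have he : eT pp (c pp x) = eA := by simp [eT, hp, hu]
        refine ⟨by rw [he]; exact hE, ?_, ?_, ?_, ?_⟩
        · rw [show DT pp (c pp x) = eA - 1 by simp [DT, he], he]; exact Cor312Prov.pred_div_le_differentOrd_of_eq (pp : ℕ) hE
        · rw [hP]; simp [PT, hp, hu]
        · rw [he]; exact WRow.inner_witness_slot (pp : ℕ) (by rw [hp]; norm_num) hE (by simp [rinT, hp, he])
        · rw [he]
          exact WRow.outer_member_min (pp : ℕ) hE (hne5 (dvd_trans (Dvd.intro (2 * l) (by ring)) hdA)) 4 5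
            (show (((pp : ℕ) : ℕ) : ℤ) = 3 by exact_mod_cast hp) (by simp [routT, hp, hu])
      · obtain ⟨hE, hP⟩ := (h3 pp x hp hx).2 hu
        have he : eT pp (c pp x) = eB := by simp [eT, hp, hu]
        refine ⟨by rw [he]; exact hE, ?_, ?_, ?_, ?_⟩
        · rw [show DT pp (c pp x) = eB - 1 by simp [DT, he], he]; exact Cor312Prov.pred_div_le_differentOrd_of_eq (pp : ℕ) hE
        · rw [hP]; simp [PT, hp, hu]
        · rw [he]; exact WRow.inner_witness_slot (pp : ℕ) (by rw [hp]; norm_num) hE (by simp [rinT, hp, he])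
        · rw [he]
          exact WRow.outer_member_min (pp : ℕ) hE (hne5 (dvd_trans (Dvd.intro (6 * l) (by ring)) hdB)) 5 6
            (show (((pp : ℕ) : ℕ) : ℤ) = 3 by exact_mod_cast hp) (by simp [routT, hp, hu])
    · -- over `47`: one type
      obtain ⟨hu, hE, hP⟩ := h47 pp x hp hx
      have hp3 : (pp : ℕ) ≠ 3 := by rw [hp]; norm_num
      have he : eT pp (c pp x) = eC := by simp [eT, hp3]
      refine ⟨by rw [he]; exact hE, ?_, ?_, ?_, ?_⟩
      · rw [show DT pp (c pp x) = eC - 1 by simp [DT, he], he]; exact Cor312Prov.pred_div_le_differentOrd_of_eq (pp : ℕ) hE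
      · rw [hP]; simp [PT, hp3]
      · rw [he, show rinT pp (c pp x) = 1 by simp [rinT, hp3]]; exact WRow.inner_witness_trivial (pp : ℕ) _ eC
      · rw [he]
        exact WRow.outer_member_min (pp : ℕ) hE
          (WRow.natCast_ne_pow_mul_sub_one Nat.prime_five pp.2 (by rw [hp]; norm_num) (by rw [hp]; norm_num)
            (dvd_trans (Dvd.intro (3 * l) (by ring)) hdC)) 1 2
          (show (((pp : ℕ) : ℕ) : ℤ) = 47 by exact_mod_cast hp) (by simp [routT, hp3])
  · -- the cells, per label and type profile
    haveI : Fact (pp : ℕ).Prime := ⟨pp.2⟩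
    have hl0 : 0 < l := by omega
    have hil : 2 * ((i : ℕ) + 1) + 1 ≤ l := by
      have h1 : (i : ℕ) < (X.l - 1) / 2 := i.isLt
      rw [hXl] at h1
      omega
    have hcard : Fintype.card ((thetaIndex X).Caps (Setting.labelSucc i)) = (i : ℕ) + 2 := by
      have hc : Fintype.card ((thetaIndex X).Caps (Setting.labelSucc i)) =
          Fintype.card (Fin (((Setting.labelSucc i : (thetaIndex X).Label) : ℕ) + 1)) := rfl
      rw [hc, Fintype.card_fin]
      simp [Setting.labelSucc]
    obtain ⟨x₀, hx₀, -⟩ := hocc (Fin.last _)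
    rcases hbad pp x₀ hx₀ with hp | hp
    · -- over `3`
      by_cases hB : ∃ a, f a = 1
      · -- a slot of the SHALLOW type B is present: take `s` there
        obtain ⟨s, hs⟩ := hB
        obtain ⟨xs, hxs, hcs⟩ := hocc s
        have hEB : absRamificationIdx (pp : ℕ) (kOf X pp.1 xs) = eB := ((h3 pp xs hp hxs).2 (hcs.trans hs)).1
        have hB0 : 0 < eB := hEB ▸ absRamificationIdx_pos (pp : ℕ) (kOf X pp.1 xs)
        refine ⟨s, WRow.forall_int_le_of_le ?_⟩
        -- Θ-side = (i+1)²/l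
        have hPe : ((((i : ℕ) + 1 : ℕ) : ℝ) ^ 2 * (PT pp (f s) : ℝ)) / (eT pp (f s) : ℝ) = ((((i : ℕ) + 1 : ℕ) : ℝ) ^ 2) / l := by
          have h1 : (PT pp (f s) : ℝ) = ((eB / l : ℕ) : ℝ) := by simp [PT, hp, hs]
          have h2 : (eT pp (f s) : ℝ) = (eB : ℝ) := by simp [eT, hp, hs]
          rw [h1, h2]
          obtain ⟨k, hk⟩ := hdB
          have hdiv : eB / l = 30 * k := by
            rw [hk, show 30 * l * k = l * (30 * k) by ring]
            exact Nat.mul_div_cancel_left _ hl0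
          rw [hdiv, hk]
          have hk0 : (0 : ℝ) < k := by
            have : 0 < k := by
              rcases Nat.eq_zero_or_pos k with h0 | h0
              · rw [hk, h0] at hB0; omega
              · exact h0
            exact_mod_cast this
          have hl0' : (0 : ℝ) < l := by exact_mod_cast hl0
          push_cast
          field_simp
        have hgain : 0 ≤ (∑ a, (DT pp (f a) : ℝ) / (eT pp (f a) : ℝ)) -
            ∑ u ∈ (Finset.univ.image f), (DT pp u : ℝ) / (eT pp u : ℝ) :=
          sub_nonneg.mpr (WRow.sum_image_le_sum f (fun u => (DT pp u : ℝ) / (eT pp u : ℝ)) fun u => by positivity)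
        have hrin : 0 ≤ ∑ a, (rinT pp (f a) : ℝ) / (eT pp (f a) : ℝ) :=
          Finset.sum_nonneg fun a _ => by
            have h0 : 0 ≤ rinT pp (f a) := by
              dsimp only [rinT]
              rw [if_pos hp]
              positivity
            have : (0 : ℝ) ≤ (rinT pp (f a) : ℝ) := by exact_mod_cast h0
            positivity
        -- q-side ≥ 2·(i+2)
        have hterm : ∀ a, (routT pp (f a) : ℝ) / (eT pp (f a) : ℝ) ≤ -2 := by
          intro a
          obtain ⟨xa, hxa, hca⟩ := hocc a
          rcases h01 (f a) with hfa | hfa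
          · have hEA : absRamificationIdx (pp : ℕ) (kOf X pp.1 xa) = eA := ((h3 pp xa hp hxa).1 (hca.trans hfa)).1
            have hA0 : 0 < eA := hEA ▸ absRamificationIdx_pos (pp : ℕ) (kOf X pp.1 xa)
            have hA50 : (50 : ℝ) ≤ eA := by
              obtain ⟨k, hk⟩ := hdA
              have h50 : 50 ≤ eA := by
                rcases Nat.eq_zero_or_pos k with h0 | h0
                · rw [hk, h0] at hA0; omega
                · rw [hk]; nlinarith
              exact_mod_cast h50
            have h1 : (routT pp (f a) : ℝ) ≤ 81 - 4 * (eA : ℝ) := by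
              have : routT pp (f a) ≤ (3 : ℤ) ^ 4 - 4 * (eA : ℤ) := by simp only [routT, hp, hfa, if_true]; exact min_le_left _ _
              have := (Int.cast_le (R := ℝ)).mpr this; push_cast at this; linarith
            have h2 : (eT pp (f a) : ℝ) = eA := by simp [eT, hp, hfa]
            rw [h2, div_le_iff₀ (by exact_mod_cast hA0)]
            linarith
          · have hB150 : (150 : ℝ) ≤ eB := by
              obtain ⟨k, hk⟩ := hdB
              have h150 : 150 ≤ eB := by
                rcases Nat.eq_zero_or_pos k with h0 | h0
                · rw [hk, h0] at hB0; omega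
                · rw [hk]; nlinarith
              exact_mod_cast h150
            have h1 : (routT pp (f a) : ℝ) ≤ 243 - 5 * (eB : ℝ) := by
              have : routT pp (f a) ≤ (3 : ℤ) ^ 5 - 5 * (eB : ℤ) := by simp only [routT, hp, hfa, if_true]; exact min_le_left _ _
              have := (Int.cast_le (R := ℝ)).mpr this; push_cast at this; linarith
            have h2 : (eT pp (f a) : ℝ) = eB := by simp [eT, hp, hfa]
            rw [h2, div_le_iff₀ (by exact_mod_cast hB0)]
            linarith
        have hsumout : ∑ a, (routT pp (f a) : ℝ) / (eT pp (f a) : ℝ) ≤ -(2 * (((i : ℕ) : ℝ) + 2)) := by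
          calc ∑ a, (routT pp (f a) : ℝ) / (eT pp (f a) : ℝ) ≤ ∑ _a : (thetaIndex X).Caps (Setting.labelSucc i), (-2 : ℝ) :=
                Finset.sum_le_sum fun a _ => hterm a
            _ = -(2 * (((i : ℕ) : ℝ) + 2)) := by
                rw [Finset.sum_const, Finset.card_univ, hcard, nsmul_eq_mul]; push_cast; ring
        have hPl : 0 ≤ (PT pp (f (Fin.last _)) : ℝ) / (eT pp (f (Fin.last _)) : ℝ) := by positivity
        have hside := WRow.broberg_cellB_side l (i : ℕ) hil
        rw [hPe]
        linarith
      · -- all slots of type A: the single-type cell of the `h = 24` place, every level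
        have hf0 : ∀ a, f a = 0 := fun a => (h01 (f a)).resolve_right fun h => hB ⟨a, h⟩
        have hf : f = fun _ => 0 := funext hf0
        subst hf
        obtain ⟨xa, hxa, hca⟩ := hocc (Fin.last _)
        have hEA : absRamificationIdx (pp : ℕ) (kOf X pp.1 xa) = eA := ((h3 pp xa hp hxa).1 hca).1
        have hA0 : 0 < eA := hEA ▸ absRamificationIdx_pos (pp : ℕ) (kOf X pp.1 xa)
        obtain ⟨k, hk⟩ := hdA
        have hk1 : 1 ≤ k := by
          rcases Nat.eq_zero_or_pos k with h0 | h0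
          · rw [hk, h0] at hA0; omega
          · exact h0
        refine ⟨Fin.last _, WRow.forall_int_le_of_le ?_⟩
        have himg : (Finset.univ : Finset ((thetaIndex X).Caps (Setting.labelSucc i))).image (fun _ => (0 : Fin 2)) = {0} :=
          Finset.image_const Finset.univ_nonempty 0
        rw [himg, Finset.sum_singleton]
        simp only [Finset.sum_const, Finset.card_univ, hcard, nsmul_eq_mul]
        have heA : eA = 10 * l * k := hk
        have he0 : (eT pp 0 : ℝ) = 10 * (l : ℝ) * k := by
          have : eT pp 0 = 10 * l * k := by simp [eT, hp, heA]
          rw [this]; push_cast; ring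
        have hD0 : (DT pp 0 : ℝ) = 10 * (l : ℝ) * k - 1 := by
          have : DT pp 0 = 10 * l * k - 1 := by simp [DT, eT, hp, heA]
          have h1 : 1 ≤ 10 * l * k := by nlinarith
          rw [this, Nat.cast_sub h1]; push_cast; ring
        have hP0 : (PT pp 0 : ℝ) = 120 * (k : ℝ) := by
          have : PT pp 0 = 120 * k := by
            have h' : 12 * eA / l = 120 * k := by
              rw [heA, show 12 * (10 * l * k) = l * (120 * k) by ring]
              exact Nat.mul_div_cancel_left _ hl0
            simp [PT, hp, h']
          rw [this]; push_cast; ring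
        have hrin0 : (rinT pp 0 : ℝ) = 5 * (l : ℝ) * k := by
          have h' : eA / 2 = 5 * l * k := by
            rw [heA, show 10 * l * k = 2 * (5 * l * k) by ring]
            exact Nat.mul_div_cancel_left _ two_pos
          have : rinT pp 0 = ((eA / 2 : ℕ) : ℤ) := by simp [rinT, eT, hp]
          rw [this, h']; push_cast; ring
        have hroutZ : routT pp 0 = min ((3 : ℤ) ^ 4 - 4 * (eA : ℤ)) ((3 : ℤ) ^ 5 - 5 * (eA : ℤ)) := by
          simp only [routT, hp, if_true]
        have hrout1 : (routT pp 0 : ℝ) ≤ 81 - 40 * (l : ℝ) * k := by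
          have : routT pp 0 ≤ (3 : ℤ) ^ 4 - 4 * (eA : ℤ) := by rw [hroutZ]; exact min_le_left _ _
          have := (Int.cast_le (R := ℝ)).mpr this; push_cast at this; rw [heA] at this; push_cast at this; linarith
        have hrout2 : (routT pp 0 : ℝ) ≤ 243 - 50 * (l : ℝ) * k := by
          have : routT pp 0 ≤ (3 : ℤ) ^ 5 - 5 * (eA : ℤ) := by rw [hroutZ]; exact min_le_right _ _
          have := (Int.cast_le (R := ℝ)).mpr this; push_cast at this; rw [heA] at this; push_cast at this; linarith
        have hkpos : (0 : ℝ) < 10 * (l : ℝ) * k := by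
          have hk1' : (1 : ℝ) ≤ k := by exact_mod_cast hk1
          have hl1 : (1 : ℝ) ≤ l := by exact_mod_cast hl0
          nlinarith
        rw [he0, hD0, hP0, hrin0]
        have hnum := WRow.broberg_cellA_num l (i : ℕ) k (routT pp 0 : ℝ) hl5 hil hk1 hrout1 hrout2
        have key := div_le_div_of_nonneg_right hnum hkpos.le
        convert key using 1 <;> first | rfl | ring
    · -- over `47`: one type, the single-type tame cell, every level
      have hp3 : (pp : ℕ) ≠ 3 := by rw [hp]; norm_num
      have hf0 : ∀ a, f a = 0 := fun a => by obtain ⟨xa, hxa, hca⟩ := hocc a; exact hca ▸ (h47 pp xa hp hxa).1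
      have hf : f = fun _ => 0 := funext hf0
      subst hf
      obtain ⟨-, hEC, -⟩ := h47 pp x₀ hp hx₀
      have hC0 : 0 < eC := hEC ▸ absRamificationIdx_pos (pp : ℕ) (kOf X pp.1 x₀)
      obtain ⟨k, hk⟩ := hdC
      have hk1 : 1 ≤ k := by
        rcases Nat.eq_zero_or_pos k with h0 | h0
        · rw [hk, h0] at hC0; omega
        · exact h0
      refine ⟨Fin.last _, WRow.forall_int_le_of_le ?_⟩
      have himg : (Finset.univ : Finset ((thetaIndex X).Caps (Setting.labelSucc i))).image (fun _ => (0 : Fin 2)) = {0} :=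
        Finset.image_const Finset.univ_nonempty 0
      rw [himg, Finset.sum_singleton]
      simp only [Finset.sum_const, Finset.card_univ, hcard, nsmul_eq_mul]
      have heC : eC = 15 * l * k := hk
      have he0 : (eT pp 0 : ℝ) = 15 * (l : ℝ) * k := by
        have : eT pp 0 = 15 * l * k := by simp [eT, hp3, heC]
        rw [this]; push_cast; ring
      have hD0 : (DT pp 0 : ℝ) = 15 * (l : ℝ) * k - 1 := by
        have : DT pp 0 = 15 * l * k - 1 := by simp [DT, eT, hp3, heC]
        have h1 : 1 ≤ 15 * l * k := by nlinarith
        rw [this, Nat.cast_sub h1]; push_cast; ring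
      have hP0 : (PT pp 0 : ℝ) = 60 * (k : ℝ) := by
        have : PT pp 0 = 60 * k := by
          have h' : 4 * eC / l = 60 * k := by
            rw [heC, show 4 * (15 * l * k) = l * (60 * k) by ring]
            exact Nat.mul_div_cancel_left _ hl0
          simp [PT, hp3, h']
        rw [this]; push_cast; ring
      have hrin0 : (rinT pp 0 : ℝ) = 1 := by simp [rinT, hp3]
      have hrout1 : (routT pp 0 : ℝ) ≤ 47 - 15 * (l : ℝ) * k := by
        have : routT pp 0 ≤ (47 : ℤ) ^ 1 - 1 * (eC : ℤ) := by simp only [routT, hp3, if_false]; exact min_le_left _ _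
        have := (Int.cast_le (R := ℝ)).mpr this; push_cast at this; rw [heC] at this; push_cast at this; linarith
      have hkpos : (0 : ℝ) < 15 * (l : ℝ) * k := by
        have hk1' : (1 : ℝ) ≤ k := by exact_mod_cast hk1
        have hl1 : (1 : ℝ) ≤ l := by exact_mod_cast hl0
        nlinarith
      rw [he0, hD0, hP0, hrin0]
      have hnum := WRow.broberg_cellC_num l (i : ℕ) k (routT pp 0 : ℝ) hil hk1 hrout1
      have key := div_le_div_of_nonneg_right hnum hkpos.le
      convert key using 1 <;> first | rfl | ring

include ht0 ht htq in
/-- **BRANCH C's PER-DATUM ANTECEDENT «∃ ρ qK, QPinned ∧ PilotKummerCompatHull» at broberg-shaped data, any level `l ≥ 5`** (any columns `col`; the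
realising q-ideles have norm `≤ 1`, abc-iut-w5-d009's `exists_qPinned_and_hull_settingPrVolSharp_iff_licence`): the per-datum S_H object of the
window certificates' binder `hSHwBad` (p453137 / p450130) is INHABITED under the hypotheses of `WRow.licence_of_brobergTypes_all`.
[cite: Mochizuki2012, IUTchIII Cor. 3.12 Step (xi-d) p. 183, (xi-f) p. 184] [cite: DupuyHilado2025, §3.3, §3.4, §4.9] [claim: Mochizuki2012, status: disputed] -/
theorem WRow.exists_qPinned_and_hull_of_brobergTypes_all {l : ℕ} (hXl : X.l = l) (hl5 : 5 ≤ l)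
    (c : ∀ pp : Nat.Primes, (thetaIndex X).Fibre (.inr pp) → Fin 2) (eA eB eC : ℕ)
    (hdA : 10 * l ∣ eA) (hdB : 30 * l ∣ eB) (hdC : 15 * l ∣ eC)
    (hbad : ∀ (pp : Nat.Primes) (x : (thetaIndex X).Fibre (.inr pp)), haveI : Fact (pp : ℕ).Prime := ⟨pp.2⟩
      placeOf X pp.1 x ∈ X.S → (pp : ℕ) = 3 ∨ (pp : ℕ) = 47)
    (h3 : ∀ (pp : Nat.Primes) (x : (thetaIndex X).Fibre (.inr pp)), haveI : Fact (pp : ℕ).Prime := ⟨pp.2⟩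
      (pp : ℕ) = 3 → placeOf X pp.1 x ∈ X.S →
        (c pp x = 0 → absRamificationIdx (pp : ℕ) (kOf X pp.1 x) = eA ∧ X.qPilot (placeOf X pp.1 x) = ((12 * eA / l : ℕ) : ℝ)) ∧
        (c pp x = 1 → absRamificationIdx (pp : ℕ) (kOf X pp.1 x) = eB ∧ X.qPilot (placeOf X pp.1 x) = ((eB / l : ℕ) : ℝ)))
    (h47 : ∀ (pp : Nat.Primes) (x : (thetaIndex X).Fibre (.inr pp)), haveI : Fact (pp : ℕ).Prime := ⟨pp.2⟩
      (pp : ℕ) = 47 → placeOf X pp.1 x ∈ X.S →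
        c pp x = 0 ∧ absRamificationIdx (pp : ℕ) (kOf X pp.1 x) = eC ∧ X.qPilot (placeOf X pp.1 x) = ((4 * eC / l : ℕ) : ℝ))
    (hiso : ∀ (pp : Nat.Primes) (x y : (thetaIndex X).Fibre (.inr pp)),
      haveI : Fact (pp : ℕ).Prime := ⟨pp.2⟩
      placeOf X pp.1 x ∈ X.S → placeOf X pp.1 y ∈ X.S → c pp x = c pp y → Nonempty (kOf X pp.1 x ≃ₐ[ℚ_[pp]] kOf X pp.1 y)) :
    ∃ (ρ' : (∀ v : (thetaIndex X).V, v ∈ (thetaIndex X).Vbad → Set ((logShellsDH X logv).StarPacket v)) →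
          ∀ (j : (thetaIndex X).Label) (vQ : (thetaIndex X).VQ), Set ((logShellsDH X logv).Packet j vQ))
      (qK : ∀ v : (thetaIndex X).V, v ∈ (thetaIndex X).Vbad → Set ((logShellsDH X logv).StarPacket v)),
      QPinned ({ toSituation := situationPrVol X hlog M archPk archSub Ψ act Mmod region, col := col } : LatticeSituation (thetaIndex X))
        (settingPrVolSharp X hlog M archPk archSub Ψ act Mmod region n lat sig split qData tq t htq0 htq1) ρ' qK ∧
      PilotKummerCompatHull ({ toSituation := situationPrVol X hlog M archPk archSub Ψ act Mmod region, col := col } :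
          LatticeSituation (thetaIndex X))
        (settingPrVolSharp X hlog M archPk archSub Ψ act Mmod region n lat sig split qData tq t htq0 htq1) ρ' qK :=
  (exists_qPinned_and_hull_settingPrVolSharp_iff_licence X hlog M archPk archSub Ψ act Mmod region n lat sig split qData tq t htq0 htq1 col
    (fun pp x => norm_qIdele_le_one_of_realises X tq htq0 htq pp x)).2
    (WRow.licence_of_brobergTypes_all X hlog M archPk archSub Ψ act Mmod region n lat sig split qData tq t htq0 htq1 ht0 ht htq hXl hl5 c eA eB
      eC hdA hdB hdC hbad h3 h47 hiso)

end Summit.ABC.IUTFork.Conditional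

end
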